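import Summits.AtomisticToContinuum.Crystallization.Theorems.FreeSplittingCertificatesRadiusLadderJoint17over15Rows2

/-!
# Joint multi-shell certificate at hard core `17/15` — OFF dispatcher rows 3/3 (`FiniteRangeSplitting`, stmt-AtomisticToContinuum-12559)

Support file (block-2b unit `b2b-freesplit-A`, gen 40): per-row dispatchers `off_row_a` collecting the OFF facts `off_a_b`; the last file ends with `off_le` — NOT summit progress.
-/

noncomputable section

namespace Summit.AtomisticToContinuum.Crystallization.Theorems.StrictSplittingRuleBirth

namespace Joint17over15

/-- Row dispatcher: the OFF facts for the pairs `(22, b)`, `22 ≤ b`. -/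
theorem off_row_22 : ∀ b : Fin NHj1715, (22 : ℕ) ≤ b → ∀ t : ℝ, -1 ≤ t → t ≤ ((cT 22 b : ℚ) : ℝ) →
    ∑ k : Fin 8, GKj1715 k 22 b * legPn (k : ℕ) t ≤ 0 := by
  intro b hab t h1 h3
  fin_cases b
  · exact absurd hab (by decide)
  · exact absurd hab (by decide)
  · exact absurd hab (by decide)
  · exact absurd hab (by decide)
  · exact absurd hab (by decide)
  · exact absurd hab (by decide)
  · exact absurd hab (by decide)
  · exact absurd hab (by decide)
  · exact absurd hab (by decide)
  · exact absurd hab (by decide)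
  · exact absurd hab (by decide)
  · exact absurd hab (by decide)
  · exact absurd hab (by decide)
  · exact absurd hab (by decide)
  · exact absurd hab (by decide)
  · exact absurd hab (by decide)
  · exact absurd hab (by decide)
  · exact absurd hab (by decide)
  · exact absurd hab (by decide)
  · exact absurd hab (by decide)
  · exact absurd hab (by decide)
  · exact absurd hab (by decide)
  · exact off_22_22 t h1 h3
  · exact off_22_23 t h1 h3

/-- Row dispatcher: the OFF facts for the pairs `(23, b)`, `23 ≤ b`. -/
theorem off_row_23 : ∀ b : Fin NHj1715, (23 : ℕ) ≤ b → ∀ t : ℝ, -1 ≤ t → t ≤ ((cT 23 b : ℚ) : ℝ) →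
    ∑ k : Fin 8, GKj1715 k 23 b * legPn (k : ℕ) t ≤ 0 := by
  intro b hab t h1 h3
  fin_cases b
  · exact absurd hab (by decide)
  · exact absurd hab (by decide)
  · exact absurd hab (by decide)
  · exact absurd hab (by decide)
  · exact absurd hab (by decide)
  · exact absurd hab (by decide)
  · exact absurd hab (by decide)
  · exact absurd hab (by decide)
  · exact absurd hab (by decide)
  · exact absurd hab (by decide)
  · exact absurd hab (by decide)
  · exact absurd hab (by decide)
  · exact absurd hab (by decide)
  · exact absurd hab (by decide)
  · exact absurd hab (by decide)
  · exact absurd hab (by decide)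
  · exact absurd hab (by decide)
  · exact absurd hab (by decide)
  · exact absurd hab (by decide)
  · exact absurd hab (by decide)
  · exact absurd hab (by decide)
  · exact absurd hab (by decide)
  · exact absurd hab (by decide)
  · exact off_23_23 t h1 h3

/-- **Dispatcher**: the OFF fact for every kernel-cell pair `a ≤ b`. -/
theorem off_le : ∀ a b : Fin NHj1715, (a : ℕ) ≤ b → ∀ t : ℝ, -1 ≤ t → t ≤ ((cT a b : ℚ) : ℝ) →
    ∑ k : Fin 8, GKj1715 k a b * legPn (k : ℕ) t ≤ 0 := by
  intro a b hab t h1 h3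
  fin_cases a
  · exact off_row_0 b hab t h1 h3
  · exact off_row_1 b hab t h1 h3
  · exact off_row_2 b hab t h1 h3
  · exact off_row_3 b hab t h1 h3
  · exact off_row_4 b hab t h1 h3
  · exact off_row_5 b hab t h1 h3
  · exact off_row_6 b hab t h1 h3
  · exact off_row_7 b hab t h1 h3
  · exact off_row_8 b hab t h1 h3
  · exact off_row_9 b hab t h1 h3
  · exact off_row_10 b hab t h1 h3
  · exact off_row_11 b hab t h1 h3
  · exact off_row_12 b hab t h1 h3
  · exact off_row_13 b hab t h1 h3
  · exact off_row_14 b hab t h1 h3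
  · exact off_row_15 b hab t h1 h3
  · exact off_row_16 b hab t h1 h3
  · exact off_row_17 b hab t h1 h3
  · exact off_row_18 b hab t h1 h3
  · exact off_row_19 b hab t h1 h3
  · exact off_row_20 b hab t h1 h3
  · exact off_row_21 b hab t h1 h3
  · exact off_row_22 b hab t h1 h3
  · exact off_row_23 b hab t h1 h3

end Joint17over15

end Summit.AtomisticToContinuum.Crystallization.Theorems.StrictSplittingRuleBirth

end
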